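import Summits.QuantumFields.Balaban3D.Proofs.Inputs

/-!
# Bałaban CMP 102 (1985), d = 3 lane — `Proofs.Residuals`: THE END THEOREM AT THE LANE'S v1 TOWER INPUT from the RESIDUAL LEAVES —
# the nine analytic step leaves per `k < K` and the four run-level leaves that the leaf seats reduce to (α) data displays; every
# other field of the 4D cell's 25-field `LeafSystem` is discharged (`Proofs.Inputs`, `Proofs.UVStability3D`)

Source: T. Bałaban, *Ultraviolet stability of three-dimensional lattice pure gauge field theories*, Commun. Math. Phys. **102** (1985)
255–275 [Balaban1985UV3] ([B10]; PDF page = journal page − 254).  Lane `pub-balaban3d`, seat p3 (PLAN §0.5 E4 / §4 STEP-5; rulings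
R-FL′, R-CONST, R-EPS0′, R-END″, R-DISP; LEAF-LEDGER §B/§C/§F).

WHAT REMAINS = `RunResiduals 𝔎 X 𝔖` (each field a LEAF-LEDGER row owned by a leaf seat, stated as the LQB leaf AT THE LANE'S PIECES
`Inputs.pieces 𝔎 X 𝔖 k` / tower `Inputs.towerOf 𝔎 X 𝔖`, to be replaced by that seat's (α)-input theorem in the follow-up file
`Proofs.UVStability3DInputs` — never by editing this one): per step k < K (`StepResiduals`): `bound55`/`bound55Lower` ((22)/(55)
and the lower twin — p4, (β) targets C1/C2), `cumulant58`/`cumulantLower` ((24)/(58)–(59) — p5 `Run3StepCumulant.cumulant58_series`,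
C3/C4), `repr33_60` ((33)/(60) — p6 `Run3Representation.repr33_60_series`, C5), `vacuumWhole` (p. 265/p. 270 — p6, C6), `decomp35_61`
((35)/(61) — p6, C7), `norm35` ((35) — p6 ← G3D-04, C8), `oldOutside` (p. 272 — p5 `oldOutside_of_bound44`, C10); per run:
`bound46` ((46) — p2 `Bound46Std.bound46_stdTowerInput`, B15), `lf` ((67)–(71) + [9] §3.C — p2 `LiftBridge.lf_tower3_lift`, B25),
`logZT_le` (p6 ← G3D-05, B20), `PprT_le` (p5 `pprT_le_series` ← G3D-01, B21).
END THEOREMS: `uvStability3D_of_residuals` — for every group a constants record `𝔎 G 𝔊`, a threshold `γ₀ G 𝔊 > 0` and, on the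
exhibited family `S.ε₀ = ε₀(S.g)`, the residual leaves ⇒ **`Theorems.Thm1AsPrintedCompact (mkT 𝔎 X 𝔖).toConstruction ∧
Theorems.Thm2AsPrintedC (mkT 𝔎 X 𝔖).toConstruction`** (via `EndTheorem.uvStability3D_grp`); `not_literal_of_residuals` — the literal
reading of Theorem 1 FAILS for the same constructed family as soon as `d(𝔤) ≥ 1` (G-B10-01; (R1) discharged by
`Inputs.unitConfig0_inputOf`, (R2) by the concrete star count, (R3) by `d(𝔤) ≥ 1`).
HONEST FRAMING (PLAN §0): UV stability of the d = 3 lattice theory on a finite torus, as printed — NOT a continuum limit, NOT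
infinite volume, NOT a mass gap, NOT d = 4, nothing about the Millennium problem; the residual leaves are hypotheses, the expansion
data are data; nothing of the paper is asserted.  No `sorry`, no new axiom.
-/

noncomputable section

namespace Summit.QuantumFields.Balaban3D.Proofs.Residuals

open Literature.MathematicalPhysics.QuantumFieldTheory.Balaban1983to89
open Literature.MathematicalPhysics.QuantumFieldTheory.Balaban1983to89.B10
open Literature.MathematicalPhysics.QuantumFieldTheory.Balaban1983to89.B10SectAGathering
open Literature.MathematicalPhysics.QuantumFieldTheory.Balaban1985CMP102
open Literature.MathematicalPhysics.QuantumFieldTheory.Balaban1985CMP102.Setting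
open Literature.MathematicalPhysics.QuantumFieldTheory.Balaban1985CMP102.Theorems
open Literature.MathematicalPhysics.QuantumFieldTheory.Balaban1985CMP102.SectB
open Summit.QuantumFields.Balaban3D.Carriers
open Summit.QuantumFields.Balaban3D.Proofs.ScalesArithmetic
open Summit.QuantumFields.Balaban3D.Proofs.Constants
open Summit.QuantumFields.Balaban3D.Proofs.UVStability3D
open Summit.QuantumFields.Balaban3D.Proofs.NegativeEdge
open Summit.QuantumFields.Balaban3D.Proofs.EndTheorem
open Summit.QuantumFields.Balaban3D.Proofs.Inputs

variable {L : ℕ}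

/-! ## §1 The residual leaves (what the leaf seats reduce to (α) displays) and the analytic bundle -/

section Residuals

variable (𝔎 : LaneConsts L) {S : Scales L} {G : Type} [GaugeGroup G] [MeasurableSpace G] [HaarData G]
  {V : Type} [NormedAddCommGroup V] [NormedSpace ℂ V]
  (X : ExternalInputs S G) (𝔖 : ∀ k, StepSeries S G V (nblkOf S 𝔎.carrier k) k)

/-- **THE RESIDUAL STEP LEAVES of step `k → k+1` AT THE LANE'S PIECES** — the nine of the fourteen `B10SectAGathering.StepLeaves`
that are ANALYTIC statements about the densities / the expansion data (the other five — `starCount`, `pintSucc`, `estep62`,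
`ztermSucc`, `rmSucc` — are discharged in §3 / by p1's `rfl` leaves), with the record's constants: `bound55` ((22) p. 261 /
(55) p. 269: the upper bound of `ρ_{k+1}` after the chart change of variables — LEAF-LEDGER C1, owner p4, a (β) target from
(48)–(54)), `bound55Lower` (its lower twin at the trivial history — C2, p4, (β)), `cumulant58` ((24)/(58)–(59), constants `Cz`,
`C₁` — C3, p5: `Run3StepCumulant.cumulant58_series` from the (3.24) inputs, G3D-02, (25)), `cumulantLower` (C4, p5), `repr33_60`
((33)/(60), `C₂` — C5, p6: `Run3Representation.repr33_60_series` from G3D-01, (28), (26), G3D-06, `hPY`), `vacuumWhole` (p. 265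
L2–4 / p. 270 L30–33, `Cv`, `C₃` — C6, p6: from G3D-01), `decomp35_61` ((35)/(61), `C₄` — C7, p6: from the (63)-localisation as
cited), `norm35` ((35), `C₅` — C8, p6: G3D-04 by name), `oldOutside` (p. 272 L29–31, `C₆` — C10, p5: `oldOutside_of_bound44` from
(44)).  HYPOTHESES, each to be replaced by its owner's (α)-input theorem; nothing asserted. [cite: Balaban1985UV3, (55)–(61) pp.269–271 + p.272] -/
structure StepResiduals (k : ℕ) : Prop where
  /-- C1 (p4): (22)/(55) -/
  bound55 : Bound55 (pieces 𝔎 X 𝔖 k)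
  /-- C2 (p4): lower twin of (22)/(55) at the trivial history -/
  bound55Lower : Bound55Lower (pieces 𝔎 X 𝔖 k)
  /-- C3 (p5): (24)/(58)–(59) -/
  cumulant58 : Cumulant58 (pieces 𝔎 X 𝔖 k) 𝔎.sc.Cz 𝔎.sc.C₁
  /-- C4 (p5): lower cumulant direction -/
  cumulantLower : CumulantLower (pieces 𝔎 X 𝔖 k) 𝔎.sc.C₁'
  /-- C5 (p6): (33)/(60) -/
  repr33_60 : Repr33_60 (pieces 𝔎 X 𝔖 k) 𝔎.sc.C₂
  /-- C6 (p6): whole-lattice vacuum sum -/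
  vacuumWhole : VacuumWhole (pieces 𝔎 X 𝔖 k) 𝔎.sc.Cv 𝔎.sc.C₃
  /-- C7 (p6): (35)/(61) -/
  decomp35_61 : Decomp35_61 (pieces 𝔎 X 𝔖 k) 𝔎.sc.C₄
  /-- C8 (p6 ← G3D-04): (35) normalisation -/
  norm35 : Norm35 (pieces 𝔎 X 𝔖 k) 𝔎.sc.C₅
  /-- C10 (p5): old terms outside Ω_{k+1}, p. 272 -/
  oldOutside : OldOutside (pieces 𝔎 X 𝔖 k) 𝔎.sc.C₆

/-- **THE RESIDUAL LEAVES OF ONE LATTICE APPROXIMATION** at the lane's tower: the residual step leaves for every `k < K`, and the four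
run-level analytic leaves of the 4D cell's `LeafSystem` — `bound46` ((46) p. 267 with `C46` — B15, p2: `Bound46Std.bound46_stdTowerInput`
from the display (44)), `lf` (the large-field control of pp. 273–274 from (67)–(71) + [9] §3.C with `d = 6/log L` — B25, p2:
`LiftBridge.lf_tower3_lift`), `logZT_le` (`|log Z^{(k)}(T₁^{(k)},1)| ≤ z|T₁^{(k)}|`, p. 273 — B20, p6: G3D-05 by name), `PprT_le`
(`|Σ_X 𝒫′_{k+1}(g_k,X,1)| ≤ aP|T₁^{(k)}|`, p. 273 from (25) — B21, p5: `pprT_le_series` from G3D-01).  HYPOTHESES; nothing asserted.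
[cite: Balaban1985UV3, (46) p.267 + (65) p.273 + pp.273–274] -/
structure RunResiduals : Prop where
  /-- the nine residual step leaves, every k < K -/
  steps : ∀ k, k + 1 ≤ S.K → StepResiduals 𝔎 X 𝔖 k
  /-- B15 (p2): (46) p. 267 -/
  bound46 : ∀ k, 1 ≤ k → k ≤ (towerOf 𝔎 X 𝔖).K → ∀ (h : (towerOf 𝔎 X 𝔖).Hist k) (U : (towerOf 𝔎 X 𝔖).Cfg k),
    |(towerOf 𝔎 X 𝔖).Pint k h U| ≤ 𝔎.consts.C46 * (towerOf 𝔎 X 𝔖).M₁ ^ 3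
      * (((towerOf 𝔎 X 𝔖).g (k - 1)) ^ 2 * (pFun (towerOf 𝔎 X 𝔖).b₀ (towerOf 𝔎 X 𝔖).p₀ ((towerOf 𝔎 X 𝔖).g (k - 1))) ^ 2)
      * (towerOf 𝔎 X 𝔖).Λvol k h
  /-- B20 (p6 ← G3D-05): |log Z^{(k)}(T₁^{(k)}, 1)| ≤ z|T₁^{(k)}| -/
  logZT_le : ∀ k, k + 1 ≤ S.K → |(pieces 𝔎 X 𝔖 k).logZT| ≤ 𝔎.F.z * S.sites k
  /-- B21 (p5 ← G3D-01): |Σ_X 𝒫′_{k+1}(g_k, X, 1)| ≤ aP|T₁^{(k)}| -/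
  PprT_le : ∀ k, k + 1 ≤ S.K → |(pieces 𝔎 X 𝔖 k).PprT| ≤ 𝔎.F.aP * S.sites k
  /-- B25 (p2): the large-field control, pp. 273–274 -/
  lf : ∀ k, k ≤ (towerOf 𝔎 X 𝔖).K → ∀ U : (towerOf 𝔎 X 𝔖).Cfg k,
    (towerOf 𝔎 X 𝔖).LF k U (fun h => -((towerOf 𝔎 X 𝔖).mainT k h U) + (towerOf 𝔎 X 𝔖).Zterm k h)
      ≤ Real.exp (𝔎.consts.d * (towerOf 𝔎 X 𝔖).sites k)

variable {𝔎 X 𝔖}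

/-- **THE FOURTEEN STEP LEAVES AT THE LANE'S PIECES** from the nine residual ones: the constants are the record's (`c₁ := 3`), the
pieces are `pieces 𝔎 X 𝔖 k`; `starCount`/`ztermSucc`/`rmSucc` from §3, `pintSucc`/`estep62` from p1's `rfl` leaves. [cite: Balaban1985UV3, (55)–(62) pp.269–271] -/
def stepLeavesOf (k : ℕ) (hk : k + 1 ≤ S.K) (R : StepResiduals 𝔎 X 𝔖 k) : StepLeaves (towerOf 𝔎 X 𝔖) k where
  P := pieces 𝔎 X 𝔖 k
  Cz := 𝔎.sc.Cz
  C₁ := 𝔎.sc.C₁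
  C₁' := 𝔎.sc.C₁'
  C₂ := 𝔎.sc.C₂
  Cv := 𝔎.sc.Cv
  C₃ := 𝔎.sc.C₃
  C₄ := 𝔎.sc.C₄
  C₅ := 𝔎.sc.C₅
  c₁ := 3
  C₆ := 𝔎.sc.C₆
  bound55 := R.bound55
  bound55Lower := R.bound55Lower
  cumulant58 := R.cumulant58
  cumulantLower := R.cumulantLower
  repr33_60 := R.repr33_60
  vacuumWhole := R.vacuumWhole
  decomp35_61 := R.decomp35_61
  norm35 := R.norm35
  starCount := starCount_pieces 𝔎 X 𝔖 k hk
  oldOutside := R.oldOutside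
  pintSucc := pintSucc_series _ _ _ k
  estep62 := estep62_series _ _ _ k
  ztermSucc := ztermSucc_pieces 𝔎 X 𝔖 k
  rmSucc := rmSucc_pieces 𝔎 X 𝔖 k

/-- **THE ANALYTIC BUNDLE OF THE END THEOREM AT THE LANE'S TOWER** from the residual leaves: `step0` (seat p4's `Step0Tower.step0_pin`;
its hypotheses — one history with `LF 0 V F = exp (F triv)` (p1 `lf_zero`), `U₀ = id` (R-K0), `Pint 0 ≡ 0` (the series' `Pint`,
R-FL) — hold by construction), `noInt0` (p1 `noInteraction0_series`), the step leaves by `stepLeavesOf`, the four run-level leaves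
verbatim, and the piece equations/bounds `starT_eq`, `rem_eq` (`rfl`), `logσ₀_le`, `dg_le` (`le_rfl`). [cite: Balaban1985UV3, pp.256–274] -/
def analyticLeavesOf (R : RunResiduals 𝔎 X 𝔖) : AnalyticLeaves 𝔎.consts S (towerOf 𝔎 X 𝔖) where
  step0 := Step0Tower.step0_pin ((inputOf 𝔎 X 𝔖).towerWith fun _ => True)
    (fun V F => lf_zero (inputOf 𝔎 X 𝔖).W V F) (fun V => by
      show (run3 ((inputOf 𝔎 X 𝔖).toRunInput fun _ => True)).Uk 0 V = V
      rw [TowerInput.ukAll_eq]; rfl) (fun _ _ => rfl)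
  noInt0 := noInteraction0_series _ _ _
  steps k hk := stepLeavesOf k hk (R.steps k hk)
  bound46 := R.bound46
  logZT_le k hk := R.logZT_le k hk
  PprT_le k hk := R.PprT_le k hk
  lf := R.lf
  starT_eq _ _ := rfl
  logσ₀_le _ _ := le_rfl
  dg_le _ _ := le_rfl
  rem_eq _ _ := rfl

end Residuals

/-! ## §2 The end theorems at the lane's tower input -/

/-- **THE END THEOREM AT THE LANE'S v1 TOWER INPUT** (PLAN §0.5 E4; supersedes HOME drafts/p3/superseded/Run3Assembly.lean, not in the tree).  For every group as
printed let a constants record `𝔎 G 𝔊` and a threshold `γ₀ G 𝔊 > 0` be given, and for every lattice approximation the external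
inputs `X G 𝔊 S` (Ū of [4], minimizers of [7], R-RN barriers) and the expansion data `𝔖 G 𝔊 S k`.  IF on the exhibited family
`S.ε₀ = ε₀(S.g) = (min γ₀ 1)²/S.g²` the RESIDUAL LEAVES `RunResiduals` hold — the nine analytic step leaves per `k < K` ((22)/(55)
and its lower twin, (24)/(58), (33)/(60), the vacuum sum, (35)/(61), (35), p. 272) and the four run-level leaves ((46), (65)-inputs,
(67)–(71)) at the lane's CONSTRUCTED pieces and tower — THEN **`Theorems.Thm1AsPrintedCompact (mkT 𝔎 X 𝔖).toConstruction ∧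
Theorems.Thm2AsPrintedC (mkT 𝔎 X 𝔖).toConstruction`**: Theorem 1 p. 257 (bounds (5), compact-coupling-window reading) and
Theorem 2 p. 272 for the densities `ρ_k = T^kρ₀` of the constructed run (Wilson density (1), the renormalization transformation of
[4] (2)/(10), `E` by (62)/(64)), each with «ε₀ … depending on the coupling constant g only» witnessed by `ε₀(g)`.  Everything
else of the 4D cell's 25-field leaf system is DISCHARGED for these carriers. [cite: Balaban1985UV3, Thm 1 p.257 + Thm 2 p.272 + p.256 L15–18] -/
theorem uvStability3D_of_residuals
    (𝔎 : ∀ (G : Type) [GaugeGroup G] [MeasurableSpace G] [HaarData G], GroupModel G → LaneConsts L)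
    (γ₀ : ∀ (G : Type) [GaugeGroup G] [MeasurableSpace G] [HaarData G], GroupModel G → ℝ)
    (hγ : ∀ (G : Type) [GaugeGroup G] [MeasurableSpace G] [HaarData G] (𝔊 : GroupModel G), 0 < γ₀ G 𝔊)
    (𝒱 : ∀ (G : Type) [GaugeGroup G] [MeasurableSpace G] [HaarData G], GroupModel G → ChartSpace)
    (X : ∀ (G : Type) [GaugeGroup G] [MeasurableSpace G] [HaarData G], GroupModel G → ∀ S : Scales L, ExternalInputs S G)
    (𝔖 : ∀ (G : Type) [GaugeGroup G] [MeasurableSpace G] [HaarData G] (𝔊 : GroupModel G) (S : Scales L) (k : ℕ),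
      StepSeries S G (𝒱 G 𝔊).V (nblkOf S (𝔎 G 𝔊).carrier k) k)
    (R : ∀ (G : Type) [GaugeGroup G] [MeasurableSpace G] [HaarData G] (𝔊 : GroupModel G) (S : Scales L),
      S.ε₀ = eps0Of (γ₀ G 𝔊) S.g → RunResiduals (𝔎 G 𝔊) (X G 𝔊 S) (𝔖 G 𝔊 S)) :
    Thm1AsPrintedCompact (mkT 𝔎 𝒱 X 𝔖).toConstruction ∧ Thm2AsPrintedC (mkT 𝔎 𝒱 X 𝔖).toConstruction :=
  uvStability3D_grp (mkT 𝔎 𝒱 X 𝔖) (fun G _ _ _ 𝔊 => (𝔎 G 𝔊).consts) (fun G _ _ _ 𝔊 => (𝔎 G 𝔊).normalised)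
    (fun G _ _ _ 𝔊 S => usesConsts_inputOf (𝔎 G 𝔊) (X G 𝔊 S) (𝔖 G 𝔊 S) fun _ => True) γ₀ hγ
    (fun G _ _ _ 𝔊 S hS => analyticLeavesOf (R G 𝔊 S hS))

/-- **THE LITERAL READING OF THEOREM 1 FAILS FOR THE SAME CONSTRUCTED FAMILY** (G-B10-01, PLAN §0.4): for ONE group as printed
with `d(𝔤) ≥ 1` (print's (18)/(22) presuppose `dim 𝔤 ≥ 1`, spine R-SEMI) and its residual leaves on the family `S.ε₀ = ε₀(S.g)`:
`(B10.Thm1PrintedCompact ∧ B10.Thm2Printed) ∧ ¬ B10.Thm1Printed` on `Theorems.runs (mkT 𝔎 X 𝔖).toConstruction G 𝔊 (eps0Of γ₀)` —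
reader's item (R1) (the unit configuration) is DISCHARGED for the constructed tower (`unitConfig0_inputOf`), (R2) by the concrete star
count, (R3) by `d(𝔤) ≥ 1`. [cite: Balaban1985UV3, Thm 1 p.257 + (62) p.271] -/
theorem not_literal_of_residuals
    (𝔎 : ∀ (G : Type) [GaugeGroup G] [MeasurableSpace G] [HaarData G], GroupModel G → LaneConsts L)
    (γ₀ : ∀ (G : Type) [GaugeGroup G] [MeasurableSpace G] [HaarData G], GroupModel G → ℝ)
    (𝒱 : ∀ (G : Type) [GaugeGroup G] [MeasurableSpace G] [HaarData G], GroupModel G → ChartSpace)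
    (X : ∀ (G : Type) [GaugeGroup G] [MeasurableSpace G] [HaarData G], GroupModel G → ∀ S : Scales L, ExternalInputs S G)
    (𝔖 : ∀ (G : Type) [GaugeGroup G] [MeasurableSpace G] [HaarData G] (𝔊 : GroupModel G) (S : Scales L) (k : ℕ),
      StepSeries S G (𝒱 G 𝔊).V (nblkOf S (𝔎 G 𝔊).carrier k) k)
    (hL : Odd L ∧ 1 < L) (G : Type) [GaugeGroup G] [MeasurableSpace G] [HaarData G] (𝔊 : GroupModel G) (hγ : 0 < γ₀ G 𝔊)
    (hdim : 1 ≤ (𝔎 G 𝔊).F.dimg)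
    (R : ∀ S : Scales L, S.ε₀ = eps0Of (γ₀ G 𝔊) S.g → RunResiduals (𝔎 G 𝔊) (X G 𝔊 S) (𝔖 G 𝔊 S)) :
    (Thm1PrintedCompact (runs (mkT 𝔎 𝒱 X 𝔖).toConstruction G 𝔊 (eps0Of (γ₀ G 𝔊)))
        ∧ Thm2Printed (runs (mkT 𝔎 𝒱 X 𝔖).toConstruction G 𝔊 (eps0Of (γ₀ G 𝔊))))
      ∧ ¬ Thm1Printed (runs (mkT 𝔎 𝒱 X 𝔖).toConstruction G 𝔊 (eps0Of (γ₀ G 𝔊))) :=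
  compact_not_literal_eps0 (mkT 𝔎 𝒱 X 𝔖).toConstruction (𝔎 G 𝔊).consts (𝔎 G 𝔊).normalised (mkT 𝔎 𝒱 X 𝔖).tower
    (fun G _ _ _ 𝔊 S => (mkT 𝔎 𝒱 X 𝔖).tower_toRunData G 𝔊 S) hL hγ G 𝔊
    (fun S hS => { toCarrierEqs := carrierEqs_pin _ (usesConsts_inputOf (𝔎 G 𝔊) (X G 𝔊 S) (𝔖 G 𝔊 S) fun _ => True),
                   toAnalyticLeaves := analyticLeavesOf (R S hS) })
    one_pos (fun S hS k hk => by show (1 : ℝ) ≤ ((𝔎 G 𝔊).F.dimg : ℝ); exact_mod_cast hdim)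
    (fun S hS => unitConfig0_inputOf (𝔎 G 𝔊) (X G 𝔊 S) (𝔖 G 𝔊 S))

end Summit.QuantumFields.Balaban3D.Proofs.Residuals

end
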